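import Summits.QuantumFields.YangMills.Theorems.BalabanUVNodesN07FramedLettersOfThm312313
import HarnessLib

/-!
# WHAT THE DISPLAYED ANTECEDENT `B9.Thm312Printed … (h1KernelRecPrN00 …) …` OF (ℓa-H)ᵖʳ ∕ (KL-H)ᵖʳ ACTUALLY ASKS: the k-uniform (3.133) sup-entry rows of `H₁^{pr}(U₀)` — nothing else

Cell `pub-ymgap` (HUMAN RULING D-0062, Track A), node N07 [B11] ∕ the K0ᴬ port wall; seat `pub-ymgap-dag-n06-l` (g43; N06 bundle F7 = [B9] Thms 3.12∕3.13 — row 20 `t312` is this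
bundle's).  LOCATED sizing of the (S) «second Sect.-D campaign» target (★★★ director-ym: HOLD; №603∕№608 keyed it on the FRAMED letters (A2)∕(A3), now in the tree).  `--kind proof
--supports stmt-QuantumFields-27238 --as helper`; count-neutral.  [B9] = [Balaban1985BackgroundPropagators]; [B11] = [Balaban1985Variational].

THE POINT.  dag-n07-e's ✓`prop4LetterHPrAtRecord_of_thm312Printed` (and this seat's staged `klH_of_thm312PrintedPr`) read the DISPLAYED antecedent
`B9.Thm312Printed 4 c35 (geoRecN00 F) (bgRecN00 F N R35 R36) GD G₁ H (h1KernelRecPrN00 F N a R35 R36 𝔥) HasRWExp HasRWExpH PosDefK` with the six slots `GD G₁ H HasRWExp HasRWExpH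
PosDefK` FREE (implicit, chosen by the supplier).  At the record geometry ✓`geoRecN00` (`Loc = Cut = Unit`, every norm letter `supNorm = l2Norm = wNorm = holder = cutH = cutSup := 0`,
`len ≡ 1`) every G-clause of Theorem 3.12 ((3.42)∕(3.46)∕(3.47) without the Laplacian, (3.43)–(3.45)) holds for the ZERO kernel family and every predicate slot is served by `True`; the `H`
slot is served by `H₁` itself; the Hölder half of (3.133) holds for `h1KernelRecPrN00` (its `h := 0`) with `Bβ := 0`.  HENCE the displayed antecedent is IMPLIED BY (and, through n07-e's
file, implies the (ℓa-H)ᵖʳ consequences of) the bare rows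
  `∃ M₄ δ₀ a₀ B₀ > 0, ∀ i, M₄ ≤ Mc_i → ∀ α₀ > 0, Mc_i·α₀ ≤ a₀ → ∀ U₀ ∈ R35 ∩ R36 (i c35 α₀), ∀ n y y′, (h1KernelRecPrN00 …).e n U₀ y y′ ≤ B₀·e^{−(δ₀∕2)·d(y,y′)}`
— print's (3.133) sup-entries `|H₁(x,y′)|, |∇H₁(x,y′)|` (n = 0, 1) of the FRAMED `H₁^{pr}(U₀)` at every framed-admissible background of the displayed classes, with `B₀, δ₀` BOUND BEFORE
THE MEMBER (k-uniform).  So the (S) campaign, stated minimally, is: inhabit THESE ROWS (XL analysis: [B9] (3.129)–(3.133) for `H₁` = (3.132) for `(QG₁Q*)⁻¹` + Theorem 3.3 for `G₁` at the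
framed record pair + the (2.61) row sums); Theorems 3.10∕3.11 and the `GD ∕ G₁` families are NOT part of what the K0ᴬ consumers read.
* §1 ★ `thm312Printed_recPr_of_eRows` — the bare e-rows ⟹ the displayed antecedent (trivial completion of the free slots; kernel-checked).
* §2 ★★ `thm312Printed_recPr_of_entryRows` — the same from the HONEST rows at ADMISSIBLE backgrounds only: `∀ hpos hQ, entry0 (H₁^{pr}(U₀)) y y′ ≤ … ∧ entry1 (H₁^{pr}(U₀)) y y′ ≤ …`
  (dag-n07-e's ✓`N07KernelEntriesOfRecord.entry0 ∕ entry1` at `T := H1prOfRecordAtBg … (𝔥 i U₀) …`; off admissibility the display's entries are `0` by definition) — the member's three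
  positivity `Fact`s as BINDERS.
HONEST FRAMING.  Bookkeeping ONLY (a sizing lemma): NOTHING of [B9] is proved; the rows themselves (= Theorem 3.12's (3.133) for `H₁` at the framed record, XL) are NOT inhabited here or
anywhere in the tree; `R35 ∕ R36`, `𝔥`, `hpos ∕ hQ` displayed; K0ᴬ ⟨stmt-QuantumFields-27238⟩ NOT closed; K0ᴬ∕K1ᴬ∕K3ᴬ 0∕3; NODE O 0∕1; COUNT 8∕28 · K 1∕4 UNMOVED; finite `𝕋⁴_{L^K}` at fixed ε —
NOT continuum ∕ ℝ⁴ ∕ OS; **the Yang–Mills mass gap (Clay) is NOT proved by any of this.**  No `sorry`, `instance`, `notation`, `set_option`; standard axioms.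
-/

noncomputable section

open scoped Matrix Matrix.Norms.L2Operator InnerProductSpace ComplexConjugate BigOperators

namespace Summit.QuantumFields.YangMills.BalabanUVNodes.N07Thm312PrintedRecPrOfEntryRows

open Literature.MathematicalPhysics.QuantumFieldTheory.Balaban1983to89
open Literature.MathematicalPhysics.QuantumFieldTheory.Balaban1983to89.Node00
open T4Continuum (T4Family)
open Summit.QuantumFields.YangMills.BalabanUVNodes.N07Prop4LetterHOfThm312 (MemberN00 bgRecN00 geoRecN00 geoRecN00_len)
open Summit.QuantumFields.YangMills.BalabanUVNodes.N07KernelEntriesOfRecord (entry0 entry1)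
open Summit.QuantumFields.YangMills.BalabanUVNodes.N07FramedLettersOfThm312313 (h1KernelRecPrN00)

variable (F : T4Family) (N : ℕ) [NeZero N] (a : ℝ)

/-! ## §1  The bare (3.133) e-rows complete to the displayed `B9.Thm312Printed` antecedent -/

/-- ★ **THE DISPLAYED ANTECEDENT FROM THE BARE (3.133) SUP-ENTRY ROWS** (node-00 record geometry): if `∃ M₄ δ₀ a₀ B₀ > 0` such that at every member `i` (`M₄ ≤ Mc_i`), every `0 < α₀`
(`Mc_i·α₀ ≤ a₀`) and every `U₀ ∈ R35 ∩ R36 (i c35 α₀)` the two sup-entries of the framed `H₁`-kernel of record obey `e n U₀ y y′ ≤ B₀·e^{−(δ₀∕2)·d(y,y′)}` (n = 0, 1), THEN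
`B9.Thm312Printed 4 c35 (geoRecN00 F) (bgRecN00 F N R35 R36) 0 0 H₁ H₁ ⊤ ⊤ ⊤` holds with the G-families ZERO, `H := H₁ := h1KernelRecPrN00 …` and every predicate slot `True` — all
G-clauses and the Hölder half of (3.133) are `0 ≤ 0` at ✓`geoRecN00` (norm letters `0`, `len ≡ 1`).  I.e. the display the K0ᴬ consumers read is EXACTLY these rows.
[cite: Balaban1985BackgroundPropagators, Thm 3.12 pp.421–423, (3.133) p.422, (3.42)–(3.47) pp.397–398] -/
theorem thm312Printed_recPr_of_eRows [Fact (0 < (F.L : ℝ))] {c35 : ℝ}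
    {R35 R36 : ∀ i : MemberN00 F, ℝ → ℝ → GaugeField (F.P i.K) 0 (SU N) → Prop}
    {𝔥 : ∀ i : MemberN00 F, (U₀ : GaugeField (F.P i.K) 0 (SU N)) → FrameDatum (F.P i.K) N i.k U₀}
    (h : ∃ M₄ δ₀ a₀ B₀ : ℝ, 0 < M₄ ∧ 0 < δ₀ ∧ 0 < a₀ ∧ 0 < B₀ ∧
      ∀ i : MemberN00 F, M₄ ≤ (i.Mc : ℝ) → ∀ α₀ : ℝ, 0 < α₀ → (i.Mc : ℝ) * α₀ ≤ a₀ →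
        ∀ U₀ : GaugeField (F.P i.K) 0 (SU N), R35 i c35 α₀ U₀ → R36 i c35 α₀ U₀ →
          ∀ (n : Fin 2) (y y' : PBond (F.P i.K) i.k),
            (h1KernelRecPrN00 F N a R35 R36 𝔥 i).e n U₀ y y' ≤ B₀ * Real.exp (-(δ₀ / 2 * (Site.tdist y.src y'.src : ℝ)))) :
    B9.Thm312Printed 4 c35 (geoRecN00 F) (bgRecN00 F N R35 R36) (fun _ => ⟨0, 0, 0, 0, 0, 0⟩) (fun _ => ⟨0, 0, 0, 0, 0, 0⟩)
      (h1KernelRecPrN00 F N a R35 R36 𝔥) (h1KernelRecPrN00 F N a R35 R36 𝔥)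
      (fun _ _ _ _ => True) (fun _ _ _ _ => True) (fun _ _ _ => True) := by
  obtain ⟨M₄, δ₀, a₀, B₀, hM₄, hδ₀, ha₀, hB₀, h⟩ := h
  refine ⟨M₄, δ₀, a₀, B₀, fun _ => 0, fun _ => 0, fun _ _ => 0, hM₄, hδ₀, ha₀, hB₀, fun i hM α₀ hα₀ hMa U₀ h35 h36 => ⟨?_, ?_⟩⟩
  · -- the G-clauses for the zero families: every right-hand side is `0` or `≥ 0` at `geoRecN00`
    intro K hK
    have hK0 : K = ⟨0, 0, 0, 0, 0, 0⟩ := by simpa using hK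
    subst hK0
    refine ⟨⟨fun n lam y y' _ _ => ?_, fun n lam c y y' _ _ => ?_, fun n lam γ _ _ _ => ?_⟩, ⟨fun β lam ζ y y' _ _ _ _ => ?_, fun ε lam y y' _ _ _ => ?_,
      fun ε β lam ζ y y' _ _ _ _ _ _ => ?_⟩, trivial, trivial⟩
    all_goals simp [geoRecN00]
  · -- the H-clause: the e-rows are the hypothesis (len ≡ 1), the Hölder half is `0 ≤ 0`
    intro Hk hHk
    have hH : Hk = h1KernelRecPrN00 F N a R35 R36 𝔥 i := by simpa using hHk
    subst hH
    refine ⟨⟨fun n y y' => ?_, fun β ζ y y' _ _ _ => ?_⟩, trivial⟩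
    · rw [geoRecN00_len, geoRecN00_len, Real.one_rpow, Real.one_rpow, mul_one, mul_one]
      exact h i hM α₀ hα₀ hMa U₀ h35 h36 n y y'
    · simp [geoRecN00, h1KernelRecPrN00]

/-! ## §2  The same from the HONEST rows: entries of `H₁^{pr}(U₀)` at framed-ADMISSIBLE backgrounds only -/

/-- ★★ **THE DISPLAYED ANTECEDENT FROM THE (3.133) ENTRY ROWS OF `H₁^{pr}(U₀)` AT ADMISSIBLE BACKGROUNDS** — the honest content of «Theorem 3.12 at the framed record» as the K0ᴬ
consumers read it: `∃ M₄ δ₀ a₀ B₀ > 0` (BEFORE the member) such that for every member `i` (`M₄ ≤ Mc_i`), `0 < α₀` (`Mc_i·α₀ ≤ a₀`), the member's positivity `Fact`s as binders, every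
`U₀ ∈ R35 ∩ R36 (i c35 α₀)` and every pair of displayed proofs `hpos hQ` of the framed pair `(Q^{pr}(U₀), Q′(U₀))`:
`entry0 (H₁^{pr}(U₀)) y y′ ≤ B₀e^{−(δ₀∕2)d(y,y′)}` and `entry1 (H₁^{pr}(U₀)) y y′ ≤ B₀e^{−(δ₀∕2)d(y,y′)}` (print's `sup_{x∈Δ(y)}|H₁(x,y′)|`, `sup|∇H₁(x,y′)|`, unit blocks).  Off admissibility the
display's entries are `0` by definition, so nothing else is asked.  THIS is the (S) target, stated minimally (XL analysis; NOT proved here).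
[cite: Balaban1985BackgroundPropagators, Thm 3.12 pp.421–423, (3.129) p.421, (3.132)–(3.133) p.422, (3.113)–(3.115) p.418; Balaban1985Variational, (45)–(46) p.285, (21) p.281] -/
theorem thm312Printed_recPr_of_entryRows [Fact (0 < (F.L : ℝ))] {c35 : ℝ}
    {R35 R36 : ∀ i : MemberN00 F, ℝ → ℝ → GaugeField (F.P i.K) 0 (SU N) → Prop}
    {𝔥 : ∀ i : MemberN00 F, (U₀ : GaugeField (F.P i.K) 0 (SU N)) → FrameDatum (F.P i.K) N i.k U₀}
    (h : ∃ M₄ δ₀ a₀ B₀ : ℝ, 0 < M₄ ∧ 0 < δ₀ ∧ 0 < a₀ ∧ 0 < B₀ ∧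
      ∀ i : MemberN00 F, M₄ ≤ (i.Mc : ℝ) → ∀ α₀ : ℝ, 0 < α₀ → (i.Mc : ℝ) * α₀ ≤ a₀ →
        ∀ [Fact (0 < (F.P i.K).eta i.k)] [Fact (0 < c0Rec F i.K i.k)] [Fact (∀ c, 0 < wBRec F i.K i.k c)],
        ∀ U₀ : GaugeField (F.P i.K) 0 (SU N), R35 i c35 α₀ U₀ → R36 i c35 α₀ U₀ →
          ∀ (hpos : ∀ x, x ≠ 0 → 0 < RCLike.re ⟪x, laplaceAOfRecord F N i.k U₀ (QprOfRecord F N i.k U₀ (𝔥 i U₀)) (QprimeOfRecord F N i.k U₀) a x⟫_ℂ)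
            (hQ : Function.Surjective (QprOfRecord F N i.k U₀ (𝔥 i U₀))) (y y' : PBond (F.P i.K) i.k),
            entry0 F N i.K i.k i.Ω U₀ i.levB (H1prOfRecordAtBg F N i.K i.k i.Ω U₀ (𝔥 i U₀) i.levB a hpos hQ) y y' ≤
                B₀ * Real.exp (-(δ₀ / 2 * (Site.tdist y.src y'.src : ℝ))) ∧
            entry1 F N i.K i.k i.Ω U₀ i.levB (H1prOfRecordAtBg F N i.K i.k i.Ω U₀ (𝔥 i U₀) i.levB a hpos hQ) y y' ≤
                B₀ * Real.exp (-(δ₀ / 2 * (Site.tdist y.src y'.src : ℝ)))) :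
    B9.Thm312Printed 4 c35 (geoRecN00 F) (bgRecN00 F N R35 R36) (fun _ => ⟨0, 0, 0, 0, 0, 0⟩) (fun _ => ⟨0, 0, 0, 0, 0, 0⟩)
      (h1KernelRecPrN00 F N a R35 R36 𝔥) (h1KernelRecPrN00 F N a R35 R36 𝔥)
      (fun _ _ _ _ => True) (fun _ _ _ _ => True) (fun _ _ _ => True) := by
  obtain ⟨M₄, δ₀, a₀, B₀, hM₄, hδ₀, ha₀, hB₀, h⟩ := h
  refine thm312Printed_recPr_of_eRows F N a ⟨M₄, δ₀, a₀, B₀, hM₄, hδ₀, ha₀, hB₀, fun i hM α₀ hα₀ hMa U₀ h35 h36 n y y' => ?_⟩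
  haveI := factEta F i.K i.k
  haveI := factC0 F i.K i.k
  haveI := wBRec_fact F i.K i.k
  have hrhs : 0 ≤ B₀ * Real.exp (-(δ₀ / 2 * (Site.tdist y.src y'.src : ℝ))) := mul_nonneg hB₀.le (Real.exp_nonneg _)
  by_cases hadm : (∀ x, x ≠ 0 → 0 < RCLike.re ⟪x, laplaceAOfRecord F N i.k U₀ (QprOfRecord F N i.k U₀ (𝔥 i U₀)) (QprimeOfRecord F N i.k U₀) a x⟫_ℂ) ∧
      Function.Surjective (QprOfRecord F N i.k U₀ (𝔥 i U₀))
  · have hrows := h i hM α₀ hα₀ hMa U₀ h35 h36 hadm.1 hadm.2 y y'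
    simp only [h1KernelRecPrN00, dif_pos hadm]
    fin_cases n
    · simpa using hrows.1
    · simpa using hrows.2
  · simp only [h1KernelRecPrN00, dif_neg hadm]
    exact hrhs

end Summit.QuantumFields.YangMills.BalabanUVNodes.N07Thm312PrintedRecPrOfEntryRows

end
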